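import Summits.QuantumFields.QCD.Theorems.GaussianLinkFramesFrameAPrioriBoundLineDefs
import Literature.MathematicalPhysics.QuantumFieldTheory.QCDPhaseQuenched

/-!
# Crux `FrameAPrioriBound` (stmt-QuantumFields-17374), line `cube-cofactor` —
# stub `stub_meanSquareOfNonreal`

REAL `z` BY CONTINUITY.  The mean-square cofactor domination on the two-cube fibre,
`E_W (Σ_{a,i,b,j} |adj(H(refit W) − z)_{(x,a,i),(y,b,j)}|)² ≤ C₂ · E_W |det(H(refit W) − z)|²`
(`H = γ₅ D_W`, `W` the re-sampled `SU(3)` links under product Haar `haarPi L`), assumed for all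
`Im z ≠ 0`, `|z| ≤ 1` with a uniform constant `C₂`, holds for ALL `|z| ≤ 1` with the SAME constant.

Proof.  Both sides are continuous functions of `z ∈ ℂ`: they are parametric integrals, over the
compact fibre `SU(3)^E` against the finite measure `haarPi L`, of integrands jointly continuous in
`(z, W)` (`hz (refit S U W) m₀ z = γ₅ D_W(refit W) − z • 1` is jointly continuous; then
`adjugate`, `det`, entries, norms, finite sums and squares), so Mathlib's
`continuous_parametric_integral_of_continuous` applies.  For `Im z = 0` put
`z_n := (1 − t_n) z + i t_n²`, `t_n := 1/(n+1) ∈ (0, 1]`: then `Im z_n = t_n² ≠ 0`,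
`|z_n| ≤ (1 − t_n) + t_n² ≤ 1` and `z_n → z`; pass to the limit in the hypothesis at `z_n`
(`le_of_tendsto_of_tendsto'`).
-/

noncomputable section

namespace Summit.QuantumFields.QCD.Cruxes.FrameAPrioriBound.CubeCofactor

open scoped BigOperators Matrix
open MeasureTheory Filter Literature.MathematicalPhysics.QuantumFieldTheory
  Literature.MathematicalPhysics.QuantumLattice Literature.Probability.LatticeModels

namespace MeanSquareOfNonreal

variable {L : ℕ}

/-- The refit `W ↦ refit S U W` is continuous on the fibre (coordinatewise a projection or a
constant). -/
theorem continuous_refit (S : Edge 4 L → Bool) (U : GaugeConfig 4 L SU3) :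
    Continuous fun W : GaugeConfig 4 L SU3 => refit S U W := by
  refine continuous_pi fun e => ?_
  by_cases h : S e = true
  · simp only [refit, h, ↓reduceIte]; exact continuous_apply e
  · simp only [refit, h, Bool.false_eq_true, ↓reduceIte]; exact continuous_const

/-- `(z, W) ↦ hz (refit S U W) m₀ z = γ₅ D_W(refit W; m₀, 1) − z • 1` is jointly continuous. -/
theorem continuous_hz_refit [NeZero L] (S : Edge 4 L → Bool) (U : GaugeConfig 4 L SU3) (m₀ : ℝ) :
    Continuous fun p : ℂ × GaugeConfig 4 L SU3 => hz (refit S U p.2) m₀ p.1 :=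
  (continuous_const.matrix_mul ((continuous_wilsonDirac (fundamentalRep (Fin 3))
    (continuous_fundamentalRep (Fin 3)) m₀ 1).comp ((continuous_refit S U).comp
      continuous_snd))).sub (continuous_fst.smul continuous_const)

/-- A jointly continuous integrand `f : ℂ → SU(3)^E → ℝ` has a continuous parametric integral
against product Haar (compact fibre, finite measure). -/
theorem continuous_integral_haarPi [NeZero L] {f : ℂ → GaugeConfig 4 L SU3 → ℝ}
    (hf : Continuous (Function.uncurry f)) : Continuous fun w => ∫ W, f w W ∂(haarPi L) := by
  haveI : IsProbabilityMeasure (haarPi L) := by dsimp only [haarPi]; infer_instance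
  have h := continuous_parametric_integral_of_continuous (μ := haarPi L) hf isCompact_univ
  simpa only [Measure.restrict_univ] using h

/-- The adjugate side `z ↦ ∫ (Σ_{a,i,b,j} |adj(hz(refit W) m₀ z)_{(x,a,i),(y,b,j)}|)² dHaar(W)` is
continuous in `z`. -/
theorem continuous_integral_adjugate [NeZero L] (x y : TorusSite 4 L) (U : GaugeConfig 4 L SU3)
    (m₀ : ℝ) :
    Continuous fun z : ℂ => ∫ W, (∑ a : Fin 3, ∑ i : Fin 4, ∑ b : Fin 3, ∑ j : Fin 4,
        ‖(hz (refit (touches x y) U W) m₀ z).adjugate (x, a, i) (y, b, j)‖) ^ 2 ∂(haarPi L) := by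
  refine continuous_integral_haarPi (f := fun (z : ℂ) (W : GaugeConfig 4 L SU3) =>
    (∑ a : Fin 3, ∑ i : Fin 4, ∑ b : Fin 3, ∑ j : Fin 4,
      ‖(hz (refit (touches x y) U W) m₀ z).adjugate (x, a, i) (y, b, j)‖) ^ 2) ?_
  have h := (continuous_hz_refit (touches x y) U m₀).matrix_adjugate
  refine (continuous_finsetSum _ fun a _ => continuous_finsetSum _ fun i _ =>
    continuous_finsetSum _ fun b _ => continuous_finsetSum _ fun j _ => ?_).pow 2
  exact (h.matrix_elem _ _).norm

/-- The determinant side `z ↦ ∫ |det(hz(refit W) m₀ z)|² dHaar(W)` is continuous in `z`. -/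
theorem continuous_integral_det [NeZero L] (x y : TorusSite 4 L) (U : GaugeConfig 4 L SU3)
    (m₀ : ℝ) :
    Continuous fun z : ℂ => ∫ W, ‖(hz (refit (touches x y) U W) m₀ z).det‖ ^ 2 ∂(haarPi L) :=
  continuous_integral_haarPi (f := fun (z : ℂ) (W : GaugeConfig 4 L SU3) =>
    ‖(hz (refit (touches x y) U W) m₀ z).det‖ ^ 2)
    ((continuous_hz_refit (touches x y) U m₀).matrix_det.norm.pow 2)

/-- The approximating sequence `z_n := (1 − t) z + i t²` (`t = 1/(n+1)`): non-real for real `z`. -/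
theorem im_approx_ne_zero {z : ℂ} (hz : z.im = 0) {t : ℝ} (ht : 0 < t) :
    (((1 - t : ℝ) : ℂ) * z + ((t ^ 2 : ℝ) : ℂ) * Complex.I).im ≠ 0 := by
  rw [Complex.add_im, Complex.im_ofReal_mul, Complex.im_ofReal_mul, Complex.I_im, hz, mul_zero,
    zero_add, mul_one]
  exact pow_ne_zero 2 ht.ne'

/-- The approximating sequence stays in the closed unit disc: `|z_n| ≤ (1 − t)|z| + t² ≤ 1`. -/
theorem norm_approx_le_one {z : ℂ} (hz : ‖z‖ ≤ 1) {t : ℝ} (ht₀ : 0 < t) (ht₁ : t ≤ 1) :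
    ‖((1 - t : ℝ) : ℂ) * z + ((t ^ 2 : ℝ) : ℂ) * Complex.I‖ ≤ 1 := by
  calc ‖((1 - t : ℝ) : ℂ) * z + ((t ^ 2 : ℝ) : ℂ) * Complex.I‖
      ≤ ‖((1 - t : ℝ) : ℂ) * z‖ + ‖((t ^ 2 : ℝ) : ℂ) * Complex.I‖ := norm_add_le _ _
    _ = (1 - t) * ‖z‖ + t ^ 2 := by
        rw [norm_mul, norm_mul, Complex.norm_real, Complex.norm_real, Complex.norm_I, mul_one,
          Real.norm_of_nonneg (sub_nonneg.mpr ht₁), Real.norm_of_nonneg (sq_nonneg t)]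
    _ ≤ 1 := by nlinarith [norm_nonneg z]

/-- `z_n → z` along `t = 1/(n+1) → 0`. -/
theorem tendsto_approx (z : ℂ) :
    Tendsto (fun n : ℕ => ((1 - 1 / ((n : ℝ) + 1) : ℝ) : ℂ) * z +
      (((1 / ((n : ℝ) + 1)) ^ 2 : ℝ) : ℂ) * Complex.I) atTop (nhds z) := by
  have hg : Continuous fun s : ℝ => ((1 - s : ℝ) : ℂ) * z + ((s ^ 2 : ℝ) : ℂ) * Complex.I := by
    fun_prop
  have h := (hg.tendsto 0).comp (tendsto_one_div_add_atTop_nhds_zero_nat (𝕜 := ℝ))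
  simp only [sub_zero, Complex.ofReal_one, one_mul, ne_eq, OfNat.ofNat_ne_zero, not_false_eq_true,
    zero_pow, Complex.ofReal_zero, zero_mul, add_zero] at h
  exact h

end MeanSquareOfNonreal

/-- STUB `meanSquareOfNonreal` (REAL `z` BY CONTINUITY).  The mean-square cofactor domination on
the two-cube fibre for `Im z ≠ 0`, `|z| ≤ 1` with a uniform constant `C₂` implies it for all
`|z| ≤ 1` with the same constant: both sides are continuous in `z` (parametric integrals of jointly
continuous integrands over the compact fibre against the finite product Haar measure), and
`z_n = (1 − 1/(n+1)) z + i/(n+1)²` is non-real, stays in the closed unit disc and tends to `z`. -/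
theorem stub_meanSquareOfNonreal :
    (∃ C₂ : ℝ, 0 < C₂ ∧ ∀ (L : ℕ) [NeZero L], 4 ≤ L →
      ∀ (m₀ : ℝ), -2 ≤ m₀ → m₀ ≤ 2 → ∀ (z : ℂ), z.im ≠ 0 → ‖z‖ ≤ 1 → ∀ (x y : TorusSite 4 L)
      (U : GaugeConfig 4 L SU3),
      ∫ W, (∑ a : Fin 3, ∑ i : Fin 4, ∑ b : Fin 3, ∑ j : Fin 4,
          ‖(hz (refit (touches x y) U W) m₀ z).adjugate (x, a, i) (y, b, j)‖) ^ 2 ∂(haarPi L) ≤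
        C₂ * ∫ W, ‖(hz (refit (touches x y) U W) m₀ z).det‖ ^ 2 ∂(haarPi L)) →
    ∃ C₂ : ℝ, 0 < C₂ ∧ ∀ (L : ℕ) [NeZero L], 4 ≤ L →
      ∀ (m₀ : ℝ), -2 ≤ m₀ → m₀ ≤ 2 → ∀ (z : ℂ), ‖z‖ ≤ 1 → ∀ (x y : TorusSite 4 L)
      (U : GaugeConfig 4 L SU3),
      ∫ W, (∑ a : Fin 3, ∑ i : Fin 4, ∑ b : Fin 3, ∑ j : Fin 4,
          ‖(hz (refit (touches x y) U W) m₀ z).adjugate (x, a, i) (y, b, j)‖) ^ 2 ∂(haarPi L) ≤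
        C₂ * ∫ W, ‖(hz (refit (touches x y) U W) m₀ z).det‖ ^ 2 ∂(haarPi L) := by
  rintro ⟨C₂, hC₂, h⟩
  refine ⟨C₂, hC₂, ?_⟩
  intro L _ hL m₀ hm₁ hm₂ z hz1 x y U
  by_cases hzim : z.im = 0
  · -- real `z`: the approximating non-real sequence in the closed disc, and the two continuous sides
    have ht₀ : ∀ n : ℕ, 0 < 1 / ((n : ℝ) + 1) := fun n => Nat.one_div_pos_of_nat
    have ht₁ : ∀ n : ℕ, 1 / ((n : ℝ) + 1) ≤ 1 := fun n =>
      (div_le_one (Nat.cast_add_one_pos n)).mpr (by linarith [n.cast_nonneg (α := ℝ)])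
    have hzs := MeanSquareOfNonreal.tendsto_approx z
    exact le_of_tendsto_of_tendsto'
      (((MeanSquareOfNonreal.continuous_integral_adjugate x y U m₀).tendsto z).comp hzs)
      ((((MeanSquareOfNonreal.continuous_integral_det x y U m₀).tendsto z).comp hzs).const_mul C₂)
      fun n => h L hL m₀ hm₁ hm₂ _ (MeanSquareOfNonreal.im_approx_ne_zero hzim (ht₀ n))
        (MeanSquareOfNonreal.norm_approx_le_one hz1 (ht₀ n) (ht₁ n)) x y U
  · exact h L hL m₀ hm₁ hm₂ z hzim hz1 x y U

end Summit.QuantumFields.QCD.Cruxes.FrameAPrioriBound.CubeCofactor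

end
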